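import Mathlib
import HarnessLib
import Summits.Ventures.LatticeQCDFlow.Exactness.SplittingIntegrator

/-!
# Palindromic splitting words (OMF2, OMF4) are reversible and volume-preserving — HMC with them is exact

HONEST FRAMING: exact (Metropolis-corrected) sampling algorithms for lattice gauge theory;
figures of merit are autocorrelation/cost numbers at stated couplings and volumes; no
continuum-physics claim.

Venture `LatticeQCDFlow` (cell pub-lqcd), topic `Exactness`, FANOUT row 9 (eng-latcore, the
engine `latflow.core.hmc.HMC(..., integrator = 'leapfrog' | 'omf2' | 'omf4')`).  NEW WORK of the
cell over Mathlib and `SplittingIntegrator.lean`; nothing is cited as a fact.  Printed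
counterparts, named only: Omelyan–Mryglod–Folk 2003 (the 5-stage second-order and 11-stage
fourth-order velocity schemes), Sexton–Weingarten 1992.

`SplittingIntegrator.lean` proved the leapfrog case end to end and the ALGEBRA for general
symmetric words (`IsFlipReversible.symmetricWord`), listing "OMF2/OMF4 as explicit
`symmetricWord` instances" as immediate but unfiled (`TYPED-EXACTNESS-MAP.md`).  Filed here: a
palindromic word `A₁ ⋯ A_k · X · A_k ⋯ A₁` of flip-reversible, `vol`-preserving stages is
flip-reversible and `vol`-preserving, so the HMC kernel built on any power of it is reversible
for `e^{−H} vol` (`palindromicHMC_isReversible`); the engine's two schemes are the instances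
`omf2Word` (`K(λε) D(ε/2) K((1−2λ)ε) D(ε/2) K(λε)`, P-first velocity form, `hmc.py` lines 82–89)
and `omf4Word` (the 11-stage word `K(ϑ) D(ρ) K(λ) D(θ) K(½−λ−ϑ) D(1−2(θ+ρ)) K(½−λ−ϑ) D(θ) K(λ)
D(ρ) K(ϑ)`, lines 90–102).  Merging the two adjacent end kicks of consecutive steps
(`K(a) K(a) = K(2a)`, as the engine does) does not change the map.  Step sizes live inside the
kick forces `gᵢ` and drift maps `dᵢ`; as in the leapfrog file nothing is assumed about the
forces beyond measurability — a wrong force or coefficient costs acceptance, never exactness.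

## Content

* `palindromicWord L X = L.prod * X * L.reverse.prod`; `palindromicWord_isFlipReversible`,
  `measurePreserving_list_prod`, `measurePreserving_palindromicWord`,
  `measurable_flip_palindromicWord_pow`.
* **`palindromicHMC_isReversible` / `_invariant`** — HMC with `n` steps of any palindromic word of
  flip-reversible `vol`-preserving stages is reversible for `e^{−H} vol`, every measurable `H`.
* `omf2Word g₁ d g₂`, `omf4Word gᵥ dᵣ gₗ dθ g_c d_c` and **`omf2HMC_isReversible`,
  `omf4HMC_isReversible`** on the phase space `Q × P` of `SplittingIntegrator.lean` (momenta in
  an additive group with Lebesgue-like `ν`, positions with drift-invariant `μ` — flat or Haar).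

Not here: orders of accuracy (2 and 4 — measured in acceptance test A4, not an exactness
question), the momentum refreshment.
-/

namespace Summit.Ventures.LatticeQCDFlow.Exactness

open MeasureTheory ProbabilityTheory

/-! ## §1 Palindromic words: algebra and measure preservation -/

section Words

variable {Ω : Type*}

/-- A palindromic splitting word `A₁ ⋯ A_k · X · A_k ⋯ A₁` (`L = [A₁, …, A_k]`, centre `X`). -/
def palindromicWord (L : List (Equiv.Perm Ω)) (X : Equiv.Perm Ω) : Equiv.Perm Ω :=
  L.prod * X * L.reverse.prod

/-- A palindromic word of `R`-reversible stages is `R`-reversible (`R` an involution). -/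
theorem palindromicWord_isFlipReversible {R X : Equiv.Perm Ω} {L : List (Equiv.Perm Ω)}
    (hR : R * R = 1) (hX : IsFlipReversible R X) (hL : ∀ A ∈ L, IsFlipReversible R A) :
    IsFlipReversible R (palindromicWord L X) :=
  IsFlipReversible.symmetricWord hR hX L hL

/-- … and so is every power of it (a trajectory of `n` steps). -/
theorem palindromicWord_pow_isFlipReversible {R X : Equiv.Perm Ω} {L : List (Equiv.Perm Ω)}
    (hR : R * R = 1) (hX : IsFlipReversible R X) (hL : ∀ A ∈ L, IsFlipReversible R A) (n : ℕ) :
    IsFlipReversible R (palindromicWord L X ^ n) :=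
  (palindromicWord_isFlipReversible hR hX hL).pow hR n

variable [MeasurableSpace Ω] {vol : Measure Ω}

/-- A product of `vol`-preserving permutations is `vol`-preserving. -/
theorem measurePreserving_list_prod {L : List (Equiv.Perm Ω)}
    (h : ∀ A ∈ L, MeasurePreserving (⇑A) vol vol) : MeasurePreserving (⇑L.prod) vol vol := by
  induction L with
  | nil => rw [List.prod_nil, Equiv.Perm.coe_one]; exact MeasurePreserving.id vol
  | cons A L ih =>
      rw [List.prod_cons, Equiv.Perm.coe_mul]
      exact (h A (by simp)).comp (ih fun B hB => h B (by simp [hB]))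

/-- A palindromic word of `vol`-preserving stages is `vol`-preserving. -/
theorem measurePreserving_palindromicWord {X : Equiv.Perm Ω} {L : List (Equiv.Perm Ω)}
    (hX : MeasurePreserving (⇑X) vol vol) (hL : ∀ A ∈ L, MeasurePreserving (⇑A) vol vol) :
    MeasurePreserving (⇑(palindromicWord L X)) vol vol := by
  unfold palindromicWord
  rw [Equiv.Perm.coe_mul, Equiv.Perm.coe_mul]
  exact ((measurePreserving_list_prod hL).comp hX).comp
    (measurePreserving_list_prod fun A hA => hL A (List.mem_reverse.mp hA))

/-- Measurability of `flip ∘ word^n` (for the statement of the HMC kernel). -/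
theorem measurable_flip_palindromicWord_pow {R X : Equiv.Perm Ω} {L : List (Equiv.Perm Ω)}
    (hR : MeasurePreserving (⇑R) vol vol) (hX : MeasurePreserving (⇑X) vol vol)
    (hL : ∀ A ∈ L, MeasurePreserving (⇑A) vol vol) (n : ℕ) :
    Measurable (⇑(R * palindromicWord L X ^ n)) := by
  rw [Equiv.Perm.coe_mul]
  exact hR.measurable.comp (measurePreserving_perm_pow (measurePreserving_palindromicWord hX hL) n).measurable

/-- **HMC with a palindromic splitting word is exact.**  `R` a `vol`-preserving involution (the
momentum flip), every stage `R`-reversible and `vol`-preserving: the Metropolis kernel proposing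
`R (word^n x)` with the test on `H` is reversible for `e^{−H} vol`, for every measurable `H` and
every `n`. -/
theorem palindromicHMC_isReversible {R X : Equiv.Perm Ω} {L : List (Equiv.Perm Ω)} {H : Ω → ℝ}
    (hH : Measurable H) (hRR : R * R = 1) (hR : MeasurePreserving (⇑R) vol vol)
    (hX : IsFlipReversible R X) (hXm : MeasurePreserving (⇑X) vol vol)
    (hL : ∀ A ∈ L, IsFlipReversible R A) (hLm : ∀ A ∈ L, MeasurePreserving (⇑A) vol vol) (n : ℕ) :
    Kernel.IsReversible
      (involMH (⇑(R * palindromicWord L X ^ n)) (measurable_flip_palindromicWord_pow hR hXm hLm n) H)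
      (vol.withDensity fun x => ENNReal.ofReal (Real.exp (-H x))) :=
  flipMH_isReversible hH (palindromicWord_pow_isFlipReversible hRR hX hL n) hR
    (measurePreserving_perm_pow (measurePreserving_palindromicWord hXm hLm) n)

/-- … and `e^{−H} vol` is invariant under that kernel. -/
theorem palindromicHMC_invariant {R X : Equiv.Perm Ω} {L : List (Equiv.Perm Ω)} {H : Ω → ℝ}
    (hH : Measurable H) (hRR : R * R = 1) (hR : MeasurePreserving (⇑R) vol vol)
    (hX : IsFlipReversible R X) (hXm : MeasurePreserving (⇑X) vol vol)
    (hL : ∀ A ∈ L, IsFlipReversible R A) (hLm : ∀ A ∈ L, MeasurePreserving (⇑A) vol vol) (n : ℕ) :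
    Kernel.Invariant
      (involMH (⇑(R * palindromicWord L X ^ n)) (measurable_flip_palindromicWord_pow hR hXm hLm n) H)
      (vol.withDensity fun x => ENNReal.ofReal (Real.exp (-H x))) :=
  flipMH_invariant hH (palindromicWord_pow_isFlipReversible hRR hX hL n) hR
    (measurePreserving_perm_pow (measurePreserving_palindromicWord hXm hLm) n)

end Words

/-! ## §2 The engine's schemes: OMF2 (5 stages) and OMF4 (11 stages), P-first velocity form -/

section OMF

variable {Q P : Type*} [AddCommGroup P]

/-- **OMF2**, one step: `K(g₁) D(d) K(g₂) D(d) K(g₁)` (engine: `g₁ = λε·F`, `g₂ = (1−2λ)ε·F`,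
`d` = drift by `ε/2`). -/
def omf2Word (g₁ : Q → P) (d : P → Equiv.Perm Q) (g₂ : Q → P) : Equiv.Perm (Q × P) :=
  palindromicWord [kick g₁, drift d] (kick g₂)

/-- **OMF4**, one step (11 stages): `K(gᵥ) D(dᵣ) K(gₗ) D(dθ) K(g_c) D(d_c) K(g_c) D(dθ) K(gₗ) D(dᵣ)
K(gᵥ)` (engine: `gᵥ = ϑε·F`, `gₗ = λε·F`, `g_c = (½−λ−ϑ)ε·F`, drifts by `ρε`, `θε`,
`(1−2(θ+ρ))ε`). -/
def omf4Word (gᵥ : Q → P) (dᵣ : P → Equiv.Perm Q) (gₗ : Q → P) (dθ : P → Equiv.Perm Q)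
    (g_c : Q → P) (d_c : P → Equiv.Perm Q) : Equiv.Perm (Q × P) :=
  palindromicWord [kick gᵥ, drift dᵣ, kick gₗ, drift dθ, kick g_c] (drift d_c)

/-- Every stage of the OMF2 word is flip-reversible … -/
theorem omf2_stages_isFlipReversible {g₁ : Q → P} {d : P → Equiv.Perm Q}
    (hd : ∀ p, d (-p) = (d p)⁻¹) :
    ∀ A ∈ [kick g₁, drift d], IsFlipReversible flip A := by
  intro A hA
  simp only [List.mem_cons, List.not_mem_nil, or_false] at hA
  rcases hA with rfl | rfl
  · exact kick_isFlipReversible g₁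
  · exact drift_isFlipReversible hd

/-- Every stage of the OMF4 word is flip-reversible … -/
theorem omf4_stages_isFlipReversible {gᵥ gₗ g_c : Q → P} {dᵣ dθ : P → Equiv.Perm Q}
    (hdᵣ : ∀ p, dᵣ (-p) = (dᵣ p)⁻¹) (hdθ : ∀ p, dθ (-p) = (dθ p)⁻¹) :
    ∀ A ∈ [kick gᵥ, drift dᵣ, kick gₗ, drift dθ, kick g_c], IsFlipReversible flip A := by
  intro A hA
  simp only [List.mem_cons, List.not_mem_nil, or_false] at hA
  rcases hA with rfl | rfl | rfl | rfl | rfl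
  · exact kick_isFlipReversible gᵥ
  · exact drift_isFlipReversible hdᵣ
  · exact kick_isFlipReversible gₗ
  · exact drift_isFlipReversible hdθ
  · exact kick_isFlipReversible g_c

variable [MeasurableSpace Q] [MeasurableSpace P] [MeasurableNeg P] [MeasurableAdd₂ P]
  {μ : Measure Q} {ν : Measure P} [ν.IsNegInvariant] [ν.IsAddRightInvariant] [SFinite μ] [SFinite ν]

omit [MeasurableNeg P] [ν.IsNegInvariant] in
/-- Every stage of the OMF2 word preserves `μ ⊗ ν`. -/
theorem omf2_stages_measurePreserving {g₁ : Q → P} {d : P → Equiv.Perm Q}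
    (hdm : Measurable fun z : P × Q => d z.1 z.2) (hdp : ∀ p, MeasurePreserving (⇑(d p)) μ μ)
    (hg₁ : Measurable g₁) :
    ∀ A ∈ [kick g₁, drift d], MeasurePreserving (⇑A) (μ.prod ν) (μ.prod ν) := by
  intro A hA
  simp only [List.mem_cons, List.not_mem_nil, or_false] at hA
  rcases hA with rfl | rfl
  · exact measurePreserving_kick hg₁
  · exact measurePreserving_drift hdm hdp

/-- **HMC with the OMF2 integrator is exact**: for any measurable forces `g₁ g₂`, any drift `d`
with the reversal law and preserving `μ`, any measurable `H`, any number of steps `n`. -/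
theorem omf2HMC_isReversible {g₁ g₂ : Q → P} {d : P → Equiv.Perm Q} {H : Q × P → ℝ}
    (hH : Measurable H) (hd : ∀ p, d (-p) = (d p)⁻¹)
    (hdm : Measurable fun z : P × Q => d z.1 z.2) (hdp : ∀ p, MeasurePreserving (⇑(d p)) μ μ)
    (hg₁ : Measurable g₁) (hg₂ : Measurable g₂) (n : ℕ) :
    Kernel.IsReversible
      (involMH (⇑((flip : Equiv.Perm (Q × P)) * omf2Word g₁ d g₂ ^ n))
        (measurable_flip_palindromicWord_pow (vol := μ.prod ν) measurePreserving_flip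
          (measurePreserving_kick hg₂)
          (omf2_stages_measurePreserving hdm hdp hg₁) n) H)
      ((μ.prod ν).withDensity fun z => ENNReal.ofReal (Real.exp (-H z))) :=
  palindromicHMC_isReversible hH flip_mul_flip measurePreserving_flip (kick_isFlipReversible g₂)
    (measurePreserving_kick hg₂) (omf2_stages_isFlipReversible hd)
    (omf2_stages_measurePreserving hdm hdp hg₁) n

omit [MeasurableNeg P] [ν.IsNegInvariant] in
/-- Every stage of the OMF4 word preserves `μ ⊗ ν`. -/
theorem omf4_stages_measurePreserving {gᵥ gₗ g_c : Q → P} {dᵣ dθ : P → Equiv.Perm Q}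
    (hdᵣm : Measurable fun z : P × Q => dᵣ z.1 z.2) (hdᵣp : ∀ p, MeasurePreserving (⇑(dᵣ p)) μ μ)
    (hdθm : Measurable fun z : P × Q => dθ z.1 z.2) (hdθp : ∀ p, MeasurePreserving (⇑(dθ p)) μ μ)
    (hgᵥ : Measurable gᵥ) (hgₗ : Measurable gₗ) (hg_c : Measurable g_c) :
    ∀ A ∈ [kick gᵥ, drift dᵣ, kick gₗ, drift dθ, kick g_c],
      MeasurePreserving (⇑A) (μ.prod ν) (μ.prod ν) := by
  intro A hA
  simp only [List.mem_cons, List.not_mem_nil, or_false] at hA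
  rcases hA with rfl | rfl | rfl | rfl | rfl
  · exact measurePreserving_kick hgᵥ
  · exact measurePreserving_drift hdᵣm hdᵣp
  · exact measurePreserving_kick hgₗ
  · exact measurePreserving_drift hdθm hdθp
  · exact measurePreserving_kick hg_c

/-- **HMC with the OMF4 (11-stage, fourth-order) integrator is exact**, for any measurable forces,
any drifts with the reversal law preserving `μ`, any measurable `H`, any number of steps. -/
theorem omf4HMC_isReversible {gᵥ gₗ g_c : Q → P} {dᵣ dθ d_c : P → Equiv.Perm Q} {H : Q × P → ℝ}
    (hH : Measurable H)
    (hdᵣ : ∀ p, dᵣ (-p) = (dᵣ p)⁻¹) (hdθ : ∀ p, dθ (-p) = (dθ p)⁻¹) (hd_c : ∀ p, d_c (-p) = (d_c p)⁻¹)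
    (hdᵣm : Measurable fun z : P × Q => dᵣ z.1 z.2) (hdᵣp : ∀ p, MeasurePreserving (⇑(dᵣ p)) μ μ)
    (hdθm : Measurable fun z : P × Q => dθ z.1 z.2) (hdθp : ∀ p, MeasurePreserving (⇑(dθ p)) μ μ)
    (hd_cm : Measurable fun z : P × Q => d_c z.1 z.2) (hd_cp : ∀ p, MeasurePreserving (⇑(d_c p)) μ μ)
    (hgᵥ : Measurable gᵥ) (hgₗ : Measurable gₗ) (hg_c : Measurable g_c) (n : ℕ) :
    Kernel.IsReversible
      (involMH (⇑((flip : Equiv.Perm (Q × P)) * omf4Word gᵥ dᵣ gₗ dθ g_c d_c ^ n))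
        (measurable_flip_palindromicWord_pow (vol := μ.prod ν) measurePreserving_flip
          (measurePreserving_drift hd_cm hd_cp)
          (omf4_stages_measurePreserving hdᵣm hdᵣp hdθm hdθp hgᵥ hgₗ hg_c) n) H)
      ((μ.prod ν).withDensity fun z => ENNReal.ofReal (Real.exp (-H z))) :=
  palindromicHMC_isReversible hH flip_mul_flip measurePreserving_flip (drift_isFlipReversible hd_c)
    (measurePreserving_drift hd_cm hd_cp) (omf4_stages_isFlipReversible hdᵣ hdθ)
    (omf4_stages_measurePreserving hdᵣm hdᵣp hdθm hdθp hgᵥ hgₗ hg_c) n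

end OMF

end Summit.Ventures.LatticeQCDFlow.Exactness
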